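import Mathlib
import HarnessLib
import Literature.Computability.QuantumComplexity.StabilizerRank

/-!
# The generic stabilizer rank `χ_n` (Lovitz–Steffan 2022, §5)

Topic `Literature/Computability/QuantumComplexity`; named facts (results in print, `def … : Prop`,
D-0014) plus ONE definition, vendored by the grounding of route `QuantumAdvantage/GenericAngle`
(cruxes `Summit.QuantumAdvantage.QuantumAdvantage.Theses.GenericAngle.GenericSpanExponential`,
`…GenericSpanSuperpoly`, `…GenericSpanSuperlinear`, support `…GenericLeMagic`). Those items quantify
over STABILIZER COVERS of the symmetric product states — families `σ : Fin r → (QReg n → ℂ)` of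
stabilizer states with `ψ^{⊗n} ∈ span σ` for every single-qubit `ψ` — and assert lower bounds on `r`;
in print this is the study of the `n`-th GENERIC STABILIZER RANK `χ_n` of Lovitz–Steffan:

B. Lovitz, V. Steffan, *New techniques for bounding stabilizer rank*, Quantum 6 (2022) 692 =
arXiv:2110.07781, §5 (held text read, tex chunks 13–14; §1.3, §1.4.2 on chunks 4–5):

* (definition, display after Fact 5.1) `χ_n = max_{[ψ] ∈ P¹} χ([ψ^{⊗n}])`; "Note that `χ_n` upper
  bounds `χ([T^{⊗n}])`."
* **Fact 5.1** "For any positive integer `n`, all but finitely many qubit states `[ψ] ∈ P¹` maximize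
  `χ([ψ^{⊗n}])`." (the Veronese curve `ν_n(P¹)` is irreducible of dimension 1, so it meets the
  secant variety `Σ_r(Stab_n)` in finitely many points or lies inside it).
* **Proposition 5.2** "`χ_n = O(2^{n/2})`." (Fact 5.1 + Qassim–Pashayan–Gosset 2021: equatorial
  states have stabilizer rank `O(2^{n/2})`; improves QPG21's `O((n+1)2^{n/2})`).
* **Proposition 5.3** "For any positive integer `n`, there exists a single set of stabilizer states
  `{[σ_1],…,[σ_{χ_n}]} ⊆ Stab_n` for which `S^n(ℂ²) ⊆ span{σ_1,…,σ_{χ_n}}`." and, right after it,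
  "Since `dim(S^n(ℂ²)) = n+1`, it follows from Proposition 5.3 that `χ_n ≥ n+1`."
* **Proposition 5.5** "Let `r` be a positive integer. If there exists a set of `n+1` distinct qubit
  states `{[ψ_1],…,[ψ_{n+1}]} ⊆ P¹` with `χ([ψ_i^{⊗n}]) ≤ r` for all `i ∈ [n+1]`, then
  `χ_n ≤ r(n+1)`." (proof: the union of the decompositions spans `S^n(ℂ²)`, because any `n+1`
  distinct `ψ_i^{⊗n}` span `S^n(ℂ²)`).
* §1.4.2: "we … only manage to modestly improve the best-known bounds on this quantity. We ask
  whether stronger bounds can be obtained" — i.e. beyond `n+1 ≤ χ_n ≤ O(2^{n/2})` NOTHING is in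
  print: superlinear / superpolynomial / exponential lower bounds on `χ_n` (the route's three cruxes)
  are open problems, and `χ_n ≥ χ(|T⟩^{⊗n}) = Ω(n)` (Peleg–Shpilka–Volk 2022, in
  `StabilizerRankLowerBounds.lean`) is the best lower bound of analytic type.

## Rendering

* `genericStabilizerRank n` is the printed MAX form, as an `ℕ`-`sSup` over all `ψ : QReg 1 → ℂ`
  (representatives of `[ψ] ∈ P¹` together with `ψ = 0`, which contributes `χ(0) = 0` for `n ≥ 1`
  and changes nothing); the set is bounded by `2ⁿ` (`stabilizerRank_le_two_pow`,
  `StabilizerSimulationProofs.lean`), so the `sSup` is a maximum and no junk value arises.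
* Cover form versus max form. If `r` stabilizer states span a space containing every `ψ^{⊗n}` then
  trivially `χ_n ≤ r`; conversely Proposition 5.3 produces such a cover with exactly `χ_n` states.
  Hence the route's cover-form items are literally lower bounds on `χ_n`:
  `GenericSpanSuperlinear ⇔ χ_n ≠ O(n)`-type statements need only the trivial direction, their
  refutations need Proposition 5.3.
* "distinct qubit states `[ψ_i] ∈ P¹`" = pairwise linearly independent nonzero vectors of `ℂ²`;
  `S^n(ℂ²)` = the amplitude functions on `QReg n = Fin n → Bool` invariant under permuting the wires.
* `n` is a standing positive integer in the source (§2, "For a positive integer `n`"); the guards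
  `0 < n` are kept as printed even where the `n = 0` case is harmless.

What is NOT here: Proposition 5.4 (`χ_n ≤ χ_n^ℝ ≤ 2χ_n`, real stabilizer states — no `Stab_n^ℝ` in
the tree), Proposition 5.6 (at most `n·C(|Stab_n|, χ_n − 1)` sub-generic states), §3–4 (subset-sum
/ Moulton lower bounds, multiplicativity examples), and the conjecture `χ_n ≥ 2^{Ω(n)}` for `|H⟩^{⊗n}`
(Bravyi–Smith–Smolin 2016, p. 7 — a conjecture, not a fact).
-/

noncomputable section

namespace Literature.Computability.QuantumComplexity

/-- The `n`-th **generic stabilizer rank** `χ_n = max_{[ψ] ∈ P¹} χ([ψ^{⊗n}])`, the largest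
stabilizer rank of an `n`-fold symmetric product state (attained by all but finitely many `[ψ]`,
Fact 5.1; `χ_n ≥ χ(|T⟩^{⊗n})`). Rendered as the `sSup` in `ℕ` of
`{χ(ψ^{⊗n}) : ψ : QReg 1 → ℂ}`, a set bounded by `2ⁿ`. [cite: LovitzSteffan2022, §5 (definition of χ_n, display after Fact 5.1)] -/
def genericStabilizerRank (n : ℕ) : ℕ :=
  sSup (Set.range fun ψ : Cryptography.QReg 1 → ℂ => stabilizerRank (tensorPow ψ n))

/-- **Lovitz–Steffan 2022, Fact 5.1** (genericity): "For any positive integer `n`, all but finitely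
many qubit states `[ψ] ∈ P¹` maximize `χ([ψ^{⊗n}])`." Rendered: for `n ≥ 1` there is a finite set
`E` of single-qubit vectors such that every nonzero `ψ` with `χ(ψ^{⊗n}) < χ_n` is a scalar
multiple of a member of `E`. Grounds the word "generic" in route `QuantumAdvantage/GenericAngle`.
[cite: LovitzSteffan2022, Fact 5.1] -/
def LovitzSteffan2022_fact51 : Prop :=
  ∀ n : ℕ, 0 < n →
    ∃ E : Finset (Cryptography.QReg 1 → ℂ), ∀ ψ : Cryptography.QReg 1 → ℂ, ψ ≠ 0 →
      stabilizerRank (tensorPow ψ n) < genericStabilizerRank n → ∃ φ ∈ E, ∃ c : ℂ, ψ = c • φ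

/-- **Lovitz–Steffan 2022, Proposition 5.2**: "`χ_n = O(2^{n/2})`" (from Fact 5.1 and
Qassim–Pashayan–Gosset 2021, equatorial states have stabilizer rank `O(2^{n/2})`). Rendered with an
explicit constant and threshold. The only upper bound in print on the quantity that crux
`Summit.QuantumAdvantage.QuantumAdvantage.Theses.GenericAngle.GenericSpanExponential` bounds from
below (so its `c` can be at most `1/2`). [cite: LovitzSteffan2022, Proposition 5.2] -/
def LovitzSteffan2022_prop52 : Prop :=
  ∃ C : ℝ, ∃ n₀ : ℕ, ∀ n : ℕ, n₀ ≤ n →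
    (genericStabilizerRank n : ℝ) ≤ C * (2 : ℝ) ^ ((n : ℝ) / 2)

/-- **Lovitz–Steffan 2022, Proposition 5.3** (one cover for the whole symmetric subspace): "For any
positive integer `n`, there exists a single set of stabilizer states `{[σ_1],…,[σ_{χ_n}]} ⊆ Stab_n`
for which `S^n(ℂ²) ⊆ span{σ_1,…,σ_{χ_n}}`." Here `S^n(ℂ²)` = the wire-permutation-invariant
amplitude functions. Converts the max form `χ_n` into the COVER form used by the items of route
`QuantumAdvantage/GenericAngle` (`…GenericSpanSuperpoly` etc.). [cite: LovitzSteffan2022, Proposition 5.3] -/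
def LovitzSteffan2022_prop53 : Prop :=
  ∀ n : ℕ, 0 < n →
    ∃ σ : Fin (genericStabilizerRank n) → Cryptography.QReg n → ℂ,
      (∀ i, σ i ∈ stabilizerStates n) ∧
      ∀ f : Cryptography.QReg n → ℂ,
        (∀ (π : Equiv.Perm (Fin n)) (x : Cryptography.QReg n), f (x ∘ π) = f x) →
          f ∈ Submodule.span ℂ (Set.range σ)

/-- **Lovitz–Steffan 2022, after Proposition 5.3** (dimension bound): "Since
`dim(S^n(ℂ²)) = n+1`, it follows from Proposition 5.3 that `χ_n ≥ n+1`." The only lower bound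
in print specific to `χ_n`; crux
`Summit.QuantumAdvantage.QuantumAdvantage.Theses.GenericAngle.GenericSpanSuperlinear` asks for
`χ_n ≠ O(n)`. [cite: LovitzSteffan2022, §5 (remark after Proposition 5.3)] -/
def LovitzSteffan2022_genericStabilizerRank_ge : Prop :=
  ∀ n : ℕ, 0 < n → n + 1 ≤ genericStabilizerRank n

/-- **Lovitz–Steffan 2022, Proposition 5.5** (cheap distinct angles bound `χ_n`): "Let `r` be a
positive integer. If there exists a set of `n+1` distinct qubit states `{[ψ_1],…,[ψ_{n+1}]} ⊆ P¹`
with `χ([ψ_i^{⊗n}]) ≤ r` for all `i ∈ [n+1]`, then `χ_n ≤ r(n+1)`." Distinct points of `P¹` =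
pairwise linearly independent vectors. The printed half of the synthesis transfer
`Summit.QuantumAdvantage.QuantumAdvantage.Theses.GenericAngle.GenericLeMagic` (whose angle supply
`ψ_j = |0⟩ + √2^j |1⟩` from `|T⟩`-gadgets is not in print). [cite: LovitzSteffan2022, Proposition 5.5] -/
def LovitzSteffan2022_prop55 : Prop :=
  ∀ (n r : ℕ), 0 < n → 0 < r →
    ∀ ψs : Fin (n + 1) → Cryptography.QReg 1 → ℂ,
      (∀ i j, i ≠ j → LinearIndependent ℂ ![ψs i, ψs j]) →
      (∀ i, stabilizerRank (tensorPow (ψs i) n) ≤ r) →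
        genericStabilizerRank n ≤ r * (n + 1)

end Literature.Computability.QuantumComplexity

end
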